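import Summits.BirchSwinnertonDyer.Rank1Residual.X11b.KolyvaginH44ConcreteData
import Summits.BirchSwinnertonDyer.Rank1Residual.X11b.KolyvaginTowerLiftConcrete
import Summits.BirchSwinnertonDyer.Rank1Residual.X11b.RingClassTowerRestriction
import HarnessLib

/-!
# Two COMPATIBLE Kolyvagin–Heegner data `d` (level `n`) and `d₀` (level `n/ℓ`): the coherence clause (β1)
# and level data for the END of the `h44` programme (cell `bsd-stepL`, seat `bsd-stepL-corner-p1` g10;
# `--supports stmt-BirchSwinnertonDyer-19947`; memo CORNER-G9 §5 step (3), CORNER-G10 §1)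

WHY/WHAT. The corner's consumers of McCallum's Prop. 4.4 — the walk's `h47` (tam3 ∕ bsd-jet:
`Koly.h47_of_prop44_of_compatData`, `JET.addOrderOf_localization_kolyvaginClass_mul_eq_of_prop44`) and the swap's
`h44c` — hold, as the typed print fact `McCallum1991.prop44_localOrder_kolyvaginClass_mul_eq` does, TWO tree data
`d : KolyvaginHeegnerData Dt β ι n` and `d₀ : KolyvaginHeegnerData Dt β ι (n/ℓ)` COMPATIBLE along `K[n/ℓ] ⊆ K[n] ⊆ ℂ`:
`d.σ q` restricts to `d₀.σ q` (`q ∣ n/ℓ`), `d.S` restricts ONTO `d₀.S` (both directions), `d.emb` restricts to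
`d₀.emb` (elements compared by their complex values). x11b3's `h44` programme (X11b/KolyvaginH44Concrete,
KolyvaginH37Bridge) runs instead on a coherent FAMILY on all divisors of one top level with the coherence clause
`hcoh` (*"the level-`n` machine of index `n/ℓ` run on `y(n/ℓ)↑` gives `P(n/ℓ)` in `E(K̄)`"*). This file bridges
the two currencies for ONE pair: (1) `toGeomPoints_derivedPoint_map_of_compat` — the four compatibility clauses
IMPLY `hcoh` at `(n, ℓ)` (x11b3's abstract engine `KolyvaginTowerLift.derivedPoint_map` twice: change of group
along `𝒢_n ≤ Aut_ℚ(K[n])`, change of level along a restriction homomorphism `res : 𝒢_n → Aut_ℚ(K[n/ℓ])`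
(`RingClassTower.exists_restrictHom`) which maps `d.S ∩ 𝒢_n` BIJECTIVELY onto `d₀.S`
(`bijOn_restrictHom_of_compat`: onto by the two restriction clauses, injective on a transversal) and the
generators onto the generators; then `emb`-compatibility); (2) `exists_levelData_of` — x11b3's
`KolyvaginH44.exists_levelData` for a family indexed by an ARBITRARY predicate `R` (junk off `R`), so that the
pair `{n, n/ℓ}` can be fed to the pair-guarded END `Prop44.h44_of_prop37_at_zhang`. HONEST FRAMING: plumbing
(group-ring ∕ Galois bookkeeping); `p`-free and image-free; nothing about BSD; no stub closes; T7.
References: [GrossLMS1991] §3 (p. 216–217: `G_n ≃ ∏ G_ℓ`, "`σ_ℓ` a fixed generator"), §4 (4.1) (`P_n = Σ_{σ∈S}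
σ D_n y_n`); [McCallumLMS1991] §4 p. 301 and the proof of Prop. 4.4 (ONE system of choices `σ_{l'}`, `S`).
-/

set_option autoImplicit false
set_option linter.dupNamespace false

noncomputable section

open scoped Classical
open WeierstrassCurve Field NumberField IsDedekindDomain Finset
open Literature.NumberTheory.EllipticCurves Literature.NumberTheory.GaloisRepresentations
open Literature.NumberTheory.EllipticCurves.KolyvaginCocycle
open Literature.NumberTheory.EllipticCurves.KolyvaginEuler
open Literature.NumberTheory.EllipticCurves.RingClassField
open Literature.NumberTheory.EllipticCurves.ModularForms
open Summit.BirchSwinnertonDyer.Rank1Residual.X11b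
open Summit.BirchSwinnertonDyer.Rank1Residual.X11b.KolyvaginTowerLift
open Summit.BirchSwinnertonDyer.Rank1Residual.X11b.RingClassTower
open Summit.BirchSwinnertonDyer.Rank1Residual.X11b.KolyvaginH44

namespace Summit.BirchSwinnertonDyer.BirchSwinnertonDyer.Theorems.Prop44

-- `K : Type`: the tree's ring-class class field theory is universe `0`.
variable {K : Type} [Field K] [NumberField K]
variable {N : ℕ} [NeZero N] {W : WeierstrassCurve ℚ} {Dt : ModularParametrizationData W N} {β : ℤ}
  {ι : K →+* ℂ}

/-! ## §1 A restriction homomorphism is injective on a transversal, and maps compatible transversals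
bijectively -/

/-- **A restriction `res : 𝒢_n → Aut_ℚ(K[m])` is injective on the transversal `d.S` of `G_n` in `𝒢_n`**
(`m ∣ n`): two representatives with the same restriction to `K[m] ⊇ K[1]` differ by an element fixing `K[1]`,
hence coincide (`d.S_transversal`). x11b3's `injOn_restrictHom_transversal` for the datum's own transversal.
[cite: GrossLMS1991, §4 (4.1)] -/
theorem injOn_restrictHom_of_transversal (hK : IsImaginaryQuadratic K) (ι : K →+* ℂ) {m n : ℕ}
    (hm : m ∣ n) (hn : n ≠ 0)
    {res : ringClassGal ι n →* (ringClassField K ι m ≃ₐ[ℚ] ringClassField K ι m)}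
    (hres : ∀ (g : ringClassGal ι n) (x : ringClassField K ι m) (y : ringClassField K ι n),
      (x : ℂ) = (y : ℂ) → ((res g x : ringClassField K ι m) : ℂ) =
        (((g : ringClassField K ι n ≃ₐ[ℚ] ringClassField K ι n) y : ringClassField K ι n) : ℂ))
    (d : KolyvaginHeegnerData Dt β ι n) :
    Set.InjOn (fun t ↦ res t)
      {t : ringClassGal ι n | (t : ringClassField K ι n ≃ₐ[ℚ] ringClassField K ι n) ∈ d.S} := by
  intro t₁ ht₁ t₂ ht₂ h12
  have hm0 : m ≠ 0 := fun h ↦ hn (Nat.eq_zero_of_zero_dvd (h ▸ hm))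
  have h1m : ringClassField K ι 1 ≤ ringClassField K ι m := ringClassField_mono hK ι (one_dvd m) hm0
  -- `res (t₁⁻¹ t₂) = 1`, so `t₁⁻¹ t₂ ∈ G_n`
  have hker : res (t₁⁻¹ * t₂) ∈ ringClassGalOver ι m 1 := by
    have : res (t₁⁻¹ * t₂) = 1 := by
      rw [map_mul, map_inv, show res t₁ = res t₂ from h12, inv_mul_cancel]
    rw [this]; exact Subgroup.one_mem _
  have hGn := mem_ringClassGalOver_of_restrictHom_mem ι hres h1m _ hker
  -- both `↑t₁` and `↑t₂` represent the `G_n`-coset of `↑t₁`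
  obtain ⟨s, -, huniq⟩ := d.S_transversal (t₁ : ringClassField K ι n ≃ₐ[ℚ] ringClassField K ι n) t₁.2
  have e1 : (t₁ : ringClassField K ι n ≃ₐ[ℚ] ringClassField K ι n) = s :=
    huniq _ ⟨ht₁, by rw [inv_mul_cancel]; exact Subgroup.one_mem _⟩
  have e2 : (t₂ : ringClassField K ι n ≃ₐ[ℚ] ringClassField K ι n) = s :=
    huniq _ ⟨ht₂, by simpa using hGn⟩
  exact Subtype.ext (e1.trans e2.symm)

/-- **Compatible transversals: `res` maps `d.S ∩ 𝒢_n` BIJECTIVELY onto `d₀.S`** (`m ∣ n`, `d` at level `n`,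
`d₀` at level `m`): onto and into by the two restriction clauses of the typed Prop. 4.4 fact (every `s ∈ d₀.S`
is the restriction of some `s' ∈ d.S`, and every `s' ∈ d.S` restricts to some `s ∈ d₀.S` — McCallum's ONE
system of coset representatives read at both levels), injective by `injOn_restrictHom_of_transversal`.
[cite: GrossLMS1991, §4 (4.1)] [cite: McCallumLMS1991, §4 (p. 301)] -/
theorem bijOn_restrictHom_of_compat (hK : IsImaginaryQuadratic K) (ι : K →+* ℂ) {m n : ℕ}
    (hm : m ∣ n) (hn : n ≠ 0)
    {res : ringClassGal ι n →* (ringClassField K ι m ≃ₐ[ℚ] ringClassField K ι m)}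
    (hres : ∀ (g : ringClassGal ι n) (x : ringClassField K ι m) (y : ringClassField K ι n),
      (x : ℂ) = (y : ℂ) → ((res g x : ringClassField K ι m) : ℂ) =
        (((g : ringClassField K ι n ≃ₐ[ℚ] ringClassField K ι n) y : ringClassField K ι n) : ℂ))
    (d : KolyvaginHeegnerData Dt β ι n) (d₀ : KolyvaginHeegnerData Dt β ι m)
    (hS₁ : ∀ s ∈ d₀.S, ∃ s' ∈ d.S, ∀ (x : ringClassField K ι m) (x' : ringClassField K ι n),
      (x : ℂ) = x' → ((s' x' : ringClassField K ι n) : ℂ) = (s x : ℂ))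
    (hS₂ : ∀ s' ∈ d.S, ∃ s ∈ d₀.S, ∀ (x : ringClassField K ι m) (x' : ringClassField K ι n),
      (x : ℂ) = x' → ((s' x' : ringClassField K ι n) : ℂ) = (s x : ℂ)) :
    Set.BijOn (fun t ↦ res t)
      {t : ringClassGal ι n | (t : ringClassField K ι n ≃ₐ[ℚ] ringClassField K ι n) ∈ d.S}
      (d₀.S : Set (ringClassField K ι m ≃ₐ[ℚ] ringClassField K ι m)) := by
  -- the restriction of `t` IS the automorphism `s` it restricts to
  have hval : ∀ (t : ringClassGal ι n) (s : ringClassField K ι m ≃ₐ[ℚ] ringClassField K ι m),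
      (∀ (x : ringClassField K ι m) (x' : ringClassField K ι n), (x : ℂ) = x' →
        (((t : ringClassField K ι n ≃ₐ[ℚ] ringClassField K ι n) x' : ringClassField K ι n) : ℂ) =
          (s x : ℂ)) → res t = s := by
    intro t s h
    ext x
    obtain ⟨y, hxy⟩ := exists_coe_eq_of_dvd hK ι hm hn x
    rw [hres t x y hxy]
    exact h x y hxy
  refine ⟨fun t ht ↦ ?_, injOn_restrictHom_of_transversal hK ι hm hn hres d, fun s hs ↦ ?_⟩
  · obtain ⟨s, hs, h⟩ := hS₂ _ ht
    change res t ∈ (d₀.S : Set _)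
    rw [Finset.mem_coe, hval t s h]
    exact hs
  · obtain ⟨s', hs', h⟩ := hS₁ s (Finset.mem_coe.mp hs)
    exact ⟨⟨s', d.S_subset s' hs'⟩, hs', hval ⟨s', d.S_subset s' hs'⟩ s h⟩

/-! ## §2 The coherence clause (β1) for a compatible pair -/

/-- **Compatibility IMPLIES coherence (β1) at the pair `(n, ℓ)`.** For `K` imaginary quadratic, a square-free `n`
with a prime factor `ℓ`, `K[n/ℓ] ≤ K[n]`, and data `d` (level `n`), `d₀` (level `n/ℓ`) compatible along
`K[n/ℓ] ⊆ K[n] ⊆ ℂ` (`hσ`, `hS₁`, `hS₂`, `hemb` — the binders of `McCallum1991.prop44_localOrder_kolyvaginClass_mul_eq`):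
the image in `E(K̄)` of the level-`n` machine of index `n/ℓ` run on `y(n/ℓ)↑` equals the image of
`P(n/ℓ) = d₀.derivedPoint` — the clause `hcoh` of x11b3's `KolyvaginH37Bridge.h37_of_traceRelation_of_congruence`
∕ `KolyvaginH44.h44_concrete_of_traceRelation_of_congruence` at this pair (Gross (4.1) with §3 "`G_n ≃ ∏ G_ℓ`":
`D_n = D_{n/ℓ}·D_ℓ`, the `S` chosen compatibly). [cite: GrossLMS1991, §3 (p. 217 l. 1–3), §4 (4.1)]
[cite: McCallumLMS1991, §4 (p. 301), Prop. 4.4 (proof, p. 302)] -/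
theorem toGeomPoints_derivedPoint_map_of_compat (hK : IsImaginaryQuadratic K) (ι : K →+* ℂ) {n ℓ : ℕ}
    (hn : Squarefree n) (hℓ : ℓ ∈ n.primeFactors)
    (hle : ringClassField K ι (n / ℓ) ≤ ringClassField K ι n)
    (d : KolyvaginHeegnerData Dt β ι n) (d₀ : KolyvaginHeegnerData Dt β ι (n / ℓ))
    (hσ : ∀ q ∈ (n / ℓ).primeFactors, ∀ (x : ringClassField K ι (n / ℓ)) (x' : ringClassField K ι n),
      (x : ℂ) = x' → ((d.σ q x' : ringClassField K ι n) : ℂ) = (d₀.σ q x : ℂ))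
    (hS₁ : ∀ s ∈ d₀.S, ∃ s' ∈ d.S, ∀ (x : ringClassField K ι (n / ℓ)) (x' : ringClassField K ι n),
      (x : ℂ) = x' → ((s' x' : ringClassField K ι n) : ℂ) = (s x : ℂ))
    (hS₂ : ∀ s' ∈ d.S, ∃ s ∈ d₀.S, ∀ (x : ringClassField K ι (n / ℓ)) (x' : ringClassField K ι n),
      (x : ℂ) = x' → ((s' x' : ringClassField K ι n) : ℂ) = (s x : ℂ))
    (hemb : ∀ (x : ringClassField K ι (n / ℓ)) (x' : ringClassField K ι n),
      (x : ℂ) = x' → d.emb x' = d₀.emb x) :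
    letI : Algebra K ℂ := ι.toAlgebra
    d.toGeomPoints
        (KolyvaginOperator.derivedPoint (pointGalHom W (ringClassField K ι n)) d.σ (n / ℓ) d.S
          (WeierstrassCurve.Affine.Point.map (W' := W)
            ((RingClassField.inclusion ι hle).restrictScalars ℚ) d₀.y)) =
      d₀.toGeomPoints d₀.derivedPoint := by
  letI : Algebra K ℂ := ι.toAlgebra
  have hn0 : n ≠ 0 := Squarefree.ne_zero hn
  have hdvd : n / ℓ ∣ n := Nat.div_dvd_of_dvd (Nat.dvd_of_mem_primeFactors hℓ)
  have hsub : (n / ℓ).primeFactors ⊆ n.primeFactors := Nat.primeFactors_mono hdvd hn0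
  -- a restriction homomorphism `res : 𝒢_n → Aut_ℚ(K[n/ℓ])`, and the identity-valued one at level `n`
  obtain ⟨res, hres⟩ := exists_restrictHom hK ι hdvd hn0
  have hresn : ∀ (g : ringClassGal ι n) (x : ringClassField K ι n) (y : ringClassField K ι n),
      (x : ℂ) = (y : ℂ) → (((ringClassGal ι n).subtype g x : ringClassField K ι n) : ℂ) =
        (((g : ringClassField K ι n ≃ₐ[ℚ] ringClassField K ι n) y : ringClassField K ι n) : ℂ) := by
    intro g x y hxy
    rw [show x = y from Subtype.ext hxy]
    rfl
  -- the generators and the transversal of `d`, inside `𝒢_n`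
  have hσmem : ∀ q ∈ n.primeFactors, d.σ q ∈ ringClassGal ι n := fun q hq ↦
    ringClassGalOver_le_ringClassGal ι n (n / q) ((d.zpowers_σ q hq) ▸ Subgroup.mem_zpowers _)
  let σ' : ℕ → ringClassGal ι n := fun q ↦
    if hq : q ∈ n.primeFactors then ⟨d.σ q, hσmem q hq⟩ else 1
  have hσ' : ∀ q ∈ (n / ℓ).primeFactors,
      (σ' q : ringClassField K ι n ≃ₐ[ℚ] ringClassField K ι n) = d.σ q := fun q hq ↦ by
    simp only [σ', dif_pos (hsub hq)]
  let S' : Finset (ringClassGal ι n) := d.S.subtype (· ∈ ringClassGal ι n)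
  have hS' : (S' : Set (ringClassGal ι n)) =
      {t : ringClassGal ι n | (t : ringClassField K ι n ≃ₐ[ℚ] ringClassField K ι n) ∈ d.S} := by
    ext t
    simp only [S', Finset.mem_coe, Finset.mem_subtype, Set.mem_setOf_eq]
  -- step 1: change of group at level `n`, along `𝒢_n ≤ Aut_ℚ(K[n])`
  have h1 : ∀ z : (W.baseChange (ringClassField K ι n)).toAffine.Point,
      KolyvaginOperator.derivedPoint ((pointGalHom W (ringClassField K ι n)).comp
          (ringClassGal ι n).subtype) σ' (n / ℓ) S' z =
        KolyvaginOperator.derivedPoint (pointGalHom W (ringClassField K ι n)) d.σ (n / ℓ) d.S z := by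
    intro z
    have h := derivedPoint_map (pointGalHom W (ringClassField K ι n))
      ((pointGalHom W (ringClassField K ι n)).comp (ringClassGal ι n).subtype)
      (ringClassGal ι n).subtype (AddMonoidHom.id _) (fun _ _ ↦ rfl)
      (σ' := σ') (σ := d.σ) (n := n / ℓ) (fun q hq ↦ hσ' q hq) (S := d.S) (S' := S')
      ⟨fun t ht ↦ by
          rw [hS'] at ht; exact Finset.mem_coe.mpr ht,
        Subtype.coe_injective.injOn,
        fun s hs ↦ ⟨⟨s, d.S_subset s (Finset.mem_coe.mp hs)⟩, by
          rw [hS']; exact Finset.mem_coe.mp hs, rfl⟩⟩ z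
    simpa using h
  -- step 2: change of level along `res`, base change along `K[n/ℓ] ⊆ K[n]`
  have h2 : KolyvaginOperator.derivedPoint ((pointGalHom W (ringClassField K ι n)).comp
        (ringClassGal ι n).subtype) σ' (n / ℓ) S'
        (WeierstrassCurve.Affine.Point.map (W' := W)
          ((RingClassField.inclusion ι hle).restrictScalars ℚ) d₀.y) =
      WeierstrassCurve.Affine.Point.map (W' := W)
          ((RingClassField.inclusion ι hle).restrictScalars ℚ) d₀.derivedPoint := by
    refine derivedPoint_map (pointGalHom W (ringClassField K ι (n / ℓ)))
      ((pointGalHom W (ringClassField K ι n)).comp (ringClassGal ι n).subtype) res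
      (WeierstrassCurve.Affine.Point.map (W' := W) ((RingClassField.inclusion ι hle).restrictScalars ℚ))
      (fun t P ↦ pointGalHom_restrictHom_map_inclusion (W := W) hK ι hdvd dvd_rfl hn0 hle hresn hres t P)
      (σ' := σ') (σ := d₀.σ) (n := n / ℓ) (fun q hq ↦ ?_) (S := d₀.S) (S' := S') ?_ d₀.y
    · -- `res (σ' q) = d₀.σ q`: both restrict `d.σ q`
      ext x
      obtain ⟨y, hxy⟩ := exists_coe_eq_of_dvd hK ι hdvd hn0 x
      rw [hres _ x y hxy, hσ' q hq]
      exact hσ q hq x y hxy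
    · rw [hS']
      exact bijOn_restrictHom_of_compat hK ι hdvd hn0 hres d d₀ hS₁ hS₂
  -- step 3: along the compatible embeddings into `K̄`
  have hee' : ∀ x' : ringClassField K ι (n / ℓ), d.emb (RingClassField.inclusion ι hle x') = d₀.emb x' :=
    fun x' ↦ hemb x' _ (RingClassField.coe_inclusion ι hle x').symm
  change WeierstrassCurve.Affine.Point.map (W' := W) d.emb.toRatAlgHom _ =
    WeierstrassCurve.Affine.Point.map (W' := W) d₀.emb.toRatAlgHom _
  rw [← h1, h2]
  exact map_toRatAlgHom_map_inclusion ι hle d.emb d₀.emb hee' _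

/-! ## §3 Level data for the END, for a family indexed by an arbitrary predicate -/

/-- **Level data at every `m : ℕ` for a family on an arbitrary index predicate `R`** — x11b3's
`KolyvaginH44.exists_levelData` VERBATIM with `m ∣ n` replaced by `R m` (square-freeness and inertness asked AT
the levels `R`): generators `σ_m`, the subgroup `H_m` (`Gal(K[m]/K[1])` pulled back to `𝒢_m`), a section `f_m`,
a point `y_m`, the restriction `π_m : Γ_K → 𝒢_m`, `j_m : E(K[m]) → E(K̄)`, a `K`-embedding `e_m`, with `hord`,
`hj`, `hπρ`, `hfsec`, `hHρ`; AT the levels `R m` the dictionary to `d m`; OFF them `j_m = 0`. Used with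
`R := {n, n/ℓ}` (two compatible data) under the pair-guarded END `Prop44.h44_of_prop37_at_zhang`.
[cite: GrossLMS1991, §3 (p. 216–217), §4 (4.1)] -/
theorem exists_levelData_of (hK : IsImaginaryQuadratic K) (ι : K →+* ℂ) (R : ℕ → Prop)
    (hsq : ∀ m, R m → Squarefree m)
    (hinert : ∀ m, R m → ∀ q ∈ m.primeFactors, (Ideal.span {(q : 𝓞 K)}).IsPrime)
    (d : (m : ℕ) → R m → KolyvaginHeegnerData Dt β ι m) (m : ℕ) :
    ∃ (σ : ℕ → ringClassGal ι m) (H : Subgroup (ringClassGal ι m))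
      (f : ringClassGal ι m ⧸ H → ringClassGal ι m)
      (y : (W.baseChange (ringClassField K ι m)).toAffine.Point)
      (π : absoluteGaloisGroup K →* ringClassGal ι m)
      (j : (W.baseChange (ringClassField K ι m)).toAffine.Point →+ geomPoints (W.baseChange K))
      (e : ringClassField K ι m →ₐ[K] AlgebraicClosure K),
      (∀ q ∈ m.primeFactors, σ q ^ (q + 1) = 1) ∧
      (∀ (τ : absoluteGaloisGroup K) (P : (W.baseChange (ringClassField K ι m)).toAffine.Point),
        j (pointGalHom W (ringClassField K ι m)
          (π τ : ringClassField K ι m ≃ₐ[ℚ] ringClassField K ι m) P) = τ • j P) ∧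
      (∀ (τ : absoluteGaloisGroup K) (x : ringClassField K ι m),
        τ • e x = e ((π τ : ringClassField K ι m ≃ₐ[ℚ] ringClassField K ι m) x)) ∧
      (∀ c, (f c : ringClassGal ι m ⧸ H) = c) ∧
      (∀ h ∈ H, (h : ringClassField K ι m ≃ₐ[ℚ] ringClassField K ι m) ∈ ringClassGalOver ι m 1) ∧
      (∀ hm : R m,
        j = (d m hm).toGeomPoints ∧ y = (d m hm).y ∧
        (∀ q ∈ m.primeFactors,
          (σ q : ringClassField K ι m ≃ₐ[ℚ] ringClassField K ι m) = (d m hm).σ q) ∧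
        (∀ c, (f c : ringClassField K ι m ≃ₐ[ℚ] ringClassField K ι m) ∈ (d m hm).S)) ∧
      (¬ R m → j = 0) := by
  by_cases hm : R m
  · -- a genuine level: the data of `d m`
    set dm := d m hm with hdm
    let e : ringClassField K ι m →ₐ[K] AlgebraicClosure K :=
      { dm.emb with commutes' := dm.emb_apply }
    have he : ∀ x, e x = dm.emb x := fun _ ↦ rfl
    obtain ⟨π, hπ⟩ := exists_absGaloisRestrict hK ι m e
    obtain ⟨f, hf, hfS⟩ := dm.exists_section_of_transversal
    have hσmem : ∀ q ∈ m.primeFactors, dm.σ q ∈ ringClassGal ι m := fun q hq ↦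
      ringClassGalOver_le_ringClassGal ι m (m / q) ((dm.zpowers_σ q hq) ▸ Subgroup.mem_zpowers _)
    let σ : ℕ → ringClassGal ι m := fun q ↦
      if hq : q ∈ m.primeFactors then ⟨dm.σ q, hσmem q hq⟩ else 1
    have hσ : ∀ q ∈ m.primeFactors,
        (σ q : ringClassField K ι m ≃ₐ[ℚ] ringClassField K ι m) = dm.σ q := fun q hq ↦ by
      simp only [σ, dif_pos hq]
    refine ⟨σ, _, f, dm.y, π, dm.toGeomPoints, e, ?_, ?_, hπ, hf, ?_, fun hm' ↦ ?_,
      fun h ↦ (h hm).elim⟩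
    · intro q hq
      apply Subtype.ext
      rw [SubmonoidClass.coe_pow, hσ q hq, OneMemClass.coe_one]
      exact dm.σ_pow_succ_eq_one hK (hsq m hm) hq (hinert m hm q hq)
    · intro τ P
      exact dm.toGeomPoints_pointGalHom (fun x ↦ by rw [← he, ← he]; exact hπ τ x) P
    · intro h hh
      exact Subgroup.mem_comap.mp hh
    · have hdd : d m hm' = dm := rfl
      rw [hdd]
      exact ⟨rfl, rfl, hσ, hfS⟩
  · -- a junk level
    obtain ⟨e⟩ := nonempty_algHom_ringClassField hK ι m
    obtain ⟨π, hπ⟩ := exists_absGaloisRestrict hK ι m e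
    refine ⟨fun _ ↦ 1, (ringClassGalOver ι m 1).comap (ringClassGal ι m).subtype,
      fun c ↦ c.out, 0, π, 0, e, fun _ _ ↦ one_pow _, fun τ P ↦ ?_, hπ,
      fun c ↦ QuotientGroup.out_eq' c, fun h hh ↦ Subgroup.mem_comap.mp hh,
      fun hm' ↦ (hm hm').elim, fun _ ↦ rfl⟩
    rw [AddMonoidHom.zero_apply, AddMonoidHom.zero_apply, smul_zero]

end Summit.BirchSwinnertonDyer.BirchSwinnertonDyer.Theorems.Prop44

end
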